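import Literature.Analysis.FluidPDE.AgeDecouplingWindows
import Literature.Analysis.FluidPDE.LongTimeAverageSubadditive
import Mathlib.MeasureTheory.Function.Floor
import HarnessLib

/-!
# Grid sums for the age-decoupling inequality: Riemann sums of absolutely continuous functions,
# counting of grid points in a window, completing the square over finitely many releases

Analysis/FluidPDE proof-support file (everything proved). Real-variable and finite-sum bookkeeping
for the GRID form of the age-decoupling argument (`FluidPDE/AgeDecouplingInequality`), in which
releases of the source profile are started at the grid times `δ, 2δ, 3δ, …` and sums over the
releases replace integrals over the release time:

* `abs_mul_sub_integral_cell_le`, `abs_sum_sub_integral_le`, `sum_sub_le_integral` — a function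
  with modulus `|F(s₂) - F(s₁)| ≤ ∫_{s₁}^{s₂} k` (`k ≥ 0`) is within `δ ∫ k` of its left/right
  Riemann sums on cells of width `δ` (plus a tail `δ M` for a partial last cell, `|F| ≤ M`);
* `grid_count` — the grid points `δ i ∈ [t - S, t)` are the `i ∈ [⌈(t-S)/δ⌉, ⌈t/δ⌉ - 1]`, there are
  between `S/δ - 1` and `S/δ + 1` of them and their cells lie in `(t - S - δ, t]`;
* `sum_sum_eq_diag_add_two_mul_upper`, `two_mul_sum_upper_le_sq_sum`,
  `sum_integral_mul_sub_upper_le` — `∑ᵢ∑ⱼ Gᵢⱼ = ∑ᵢ Gᵢᵢ + 2∑_{i<j} Gᵢⱼ` for symmetric `G`, hence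
  `2∑_{i<j} aᵢaⱼ ≤ (∑ aᵢ)²` for `a ≥ 0` and the completing-the-square inequality
  `δ∑ᵢ∫θAᵢ - δ²∑_{i<j}∫AᵢAⱼ ≤ ½∫θ² + ½δ²∑ᵢ∫Aᵢ²` (`‖Y‖² = δ²∑‖Aᵢ‖² + 2δ²∑_{i<j}(Aᵢ,Aⱼ)`,
  `(θ, Y) ≤ ½‖θ‖² + ½‖Y‖²` for `Y = δ∑Aᵢ`).

No single printed source: standard real analysis and linear algebra. [folklore]
-/

noncomputable section

open _root_.MeasureTheory _root_.Set _root_.Filter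
open scoped _root_.Topology

namespace Literature.Analysis.FluidPDE

namespace AgeDecoupling

/-! ## Riemann sums of functions with an integrable modulus -/

section Riemann

variable {F k : ℝ → ℝ}

/-- **One cell.** If `|F(c) - F(s)| ≤ ∫ₛᶜ k` for `s ∈ [c-δ, c]` with `k ≥ 0` interval integrable,
then `|δ F(c) - ∫_{c-δ}^c F| ≤ δ ∫_{c-δ}^c k`. [folklore] -/
theorem abs_mul_sub_integral_cell_le {c δ : ℝ} (hδ : 0 ≤ δ) (hk0 : ∀ x, 0 ≤ k x)
    (hk : IntervalIntegrable k volume (c - δ) c) (hFi : IntervalIntegrable F volume (c - δ) c)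
    (hF : ∀ s ∈ Icc (c - δ) c, |F c - F s| ≤ ∫ x in s..c, k x) :
    |δ * F c - ∫ x in (c - δ)..c, F x| ≤ δ * ∫ x in (c - δ)..c, k x := by
  have hcδ : c - δ ≤ c := by linarith
  set K : ℝ := ∫ x in (c - δ)..c, k x with hK
  have hK0 : 0 ≤ K := intervalIntegral.integral_nonneg hcδ fun x _ => hk0 x
  -- `δ F(c) - ∫ F = ∫ (F c - F s) ds`
  have e : δ * F c - ∫ x in (c - δ)..c, F x = ∫ s in (c - δ)..c, (F c - F s) := by
    rw [intervalIntegral.integral_sub intervalIntegrable_const hFi, intervalIntegral.integral_const, smul_eq_mul]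
    ring
  rw [e]
  have hbound : ∀ s ∈ Set.uIoc (c - δ) c, ‖F c - F s‖ ≤ K := by
    intro s hs
    rw [uIoc_of_le hcδ] at hs
    rw [Real.norm_eq_abs]
    refine (hF s ⟨hs.1.le, hs.2⟩).trans ?_
    exact intervalIntegral.integral_mono_interval hs.1.le hs.2 le_rfl
      (ae_of_all _ fun x => hk0 x) hk
  have h := intervalIntegral.norm_integral_le_of_norm_le_const hbound
  rw [Real.norm_eq_abs, show |c - (c - δ)| = δ by rw [sub_sub_cancel, abs_of_nonneg hδ]] at h
  linarith [h]

/-- **Consecutive cells.** For the grid points `δ(i₀ + j)`, `j < L`, with cells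
`(δ(i₀+j) - δ, δ(i₀+j)]` covering `(x₀, x₀ + δL]`, `x₀ = δ i₀ - δ`:
`|δ ∑_{j<L} F(δ(i₀+j)) - ∫_{x₀}^{x₀+δL} F| ≤ δ ∫_{x₀}^{x₀+δL} k`. [folklore] -/
theorem abs_sum_sub_integral_le {δ : ℝ} (hδ : 0 < δ) (i₀ L : ℕ) (hk0 : ∀ x, 0 ≤ k x)
    (hk : IntervalIntegrable k volume (δ * i₀ - δ) (δ * i₀ - δ + δ * L))
    (hFi : IntervalIntegrable F volume (δ * i₀ - δ) (δ * i₀ - δ + δ * L))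
    (hF : ∀ s₁ s₂, δ * i₀ - δ ≤ s₁ → s₁ ≤ s₂ → s₂ ≤ δ * i₀ - δ + δ * L → |F s₂ - F s₁| ≤ ∫ x in s₁..s₂, k x) :
    |δ * ∑ j ∈ Finset.range L, F (δ * (i₀ + j)) - ∫ x in (δ * i₀ - δ)..(δ * i₀ - δ + δ * L), F x| ≤
      δ * ∫ x in (δ * i₀ - δ)..(δ * i₀ - δ + δ * L), k x := by
  set a : ℕ → ℝ := fun j => δ * i₀ - δ + δ * j with ha
  have ha0 : a 0 = δ * i₀ - δ := by simp [ha]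
  have haL : a L = δ * i₀ - δ + δ * L := rfl
  have hmono : ∀ {j j' : ℕ}, j ≤ j' → a j ≤ a j' := fun h => by
    simp only [ha]; have := hδ.le; nlinarith [show (↑_ : ℝ) ≤ ↑_ from Nat.cast_le.2 h]
  have hcell : ∀ j, a (j + 1) = δ * (i₀ + j) := fun j => by simp only [ha]; push_cast; ring
  have hcell' : ∀ j, a (j + 1) - δ = a j := fun j => by simp only [ha]; push_cast; ring
  -- interval integrability on sub-intervals
  have h0L : a 0 ≤ a L := hmono (Nat.zero_le _)
  have hsub : ∀ j ≤ L, ∀ j' ≤ L, IntervalIntegrable k volume (a j) (a j') ∧ IntervalIntegrable F volume (a j) (a j') := by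
    intro j hj j' hj'
    have h0j : a 0 ≤ a j := hmono (Nat.zero_le _)
    have hjL : a j ≤ a L := hmono hj
    have h0j' : a 0 ≤ a j' := hmono (Nat.zero_le _)
    have hj'L : a j' ≤ a L := hmono hj'
    have hss : uIcc (a j) (a j') ⊆ uIcc (a 0) (a L) := by
      rw [uIcc_of_le h0L]; exact uIcc_subset_Icc ⟨h0j, hjL⟩ ⟨h0j', hj'L⟩
    have hk₀ : IntervalIntegrable k volume (a 0) (a L) := by rw [ha0]; exact hk
    have hF₀ : IntervalIntegrable F volume (a 0) (a L) := by rw [ha0]; exact hFi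
    exact ⟨hk₀.mono_set hss, hF₀.mono_set hss⟩
  -- split the integrals over the cells
  have hsumF : ∑ j ∈ Finset.range L, ∫ x in a j..a (j + 1), F x = ∫ x in a 0..a L, F x :=
    intervalIntegral.sum_integral_adjacent_intervals fun j hj => (hsub j hj.le (j + 1) hj).2
  have hsumk : ∑ j ∈ Finset.range L, ∫ x in a j..a (j + 1), k x = ∫ x in a 0..a L, k x :=
    intervalIntegral.sum_integral_adjacent_intervals fun j hj => (hsub j hj.le (j + 1) hj).1
  rw [← haL, ← ha0, ← hsumF, ← hsumk, Finset.mul_sum, Finset.mul_sum, ← Finset.sum_sub_distrib]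
  refine (Finset.abs_sum_le_sum_abs _ _).trans (Finset.sum_le_sum fun j hj => ?_)
  have hjL : j + 1 ≤ L := Finset.mem_range.1 hj
  -- the cell estimate at `c = a (j+1)`
  have hcint := hsub j (by omega) (j + 1) hjL
  have h1 := abs_mul_sub_integral_cell_le (F := F) (k := k) (c := a (j + 1)) hδ.le hk0
    (by rw [hcell']; exact hcint.1) (by rw [hcell']; exact hcint.2) (fun s hs => by
      rw [hcell'] at hs
      have := hF s (a (j + 1)) (by have := hmono (Nat.zero_le j); rw [ha0] at this; linarith [hs.1]) hs.2 (hmono hjL)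
      exact this)
  rw [hcell', hcell] at h1
  rw [hcell]
  exact h1

/-- **Right Riemann sum from below, with a partial last cell.** On `[0, ℓ]`, `ℓ > 0`, with
`N = ⌊ℓ/δ⌋` full cells: `δ ∑_{j<N} F(δ(j+1)) - δ ∫₀^ℓ k - δ M ≤ ∫₀^ℓ F` if moreover `|F| ≤ M` on
`[0, ℓ]`. [folklore] -/
theorem sum_sub_le_integral {δ ℓ M : ℝ} (hδ : 0 < δ) (hℓ : 0 ≤ ℓ) (hk0 : ∀ x, 0 ≤ k x)
    (hk : IntervalIntegrable k volume 0 ℓ) (hFi : IntervalIntegrable F volume 0 ℓ)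
    (hF : ∀ s₁ s₂, 0 ≤ s₁ → s₁ ≤ s₂ → s₂ ≤ ℓ → |F s₂ - F s₁| ≤ ∫ x in s₁..s₂, k x)
    (hM : ∀ s ∈ Icc 0 ℓ, |F s| ≤ M) :
    δ * ∑ j ∈ Finset.range ⌊ℓ / δ⌋₊, F (δ * (j + 1)) - δ * (∫ x in (0 : ℝ)..ℓ, k x) - δ * M ≤
      ∫ x in (0 : ℝ)..ℓ, F x := by
  set N : ℕ := ⌊ℓ / δ⌋₊ with hN
  have hNle : δ * N ≤ ℓ := by
    have h1 : (N : ℝ) ≤ ℓ / δ := Nat.floor_le (div_nonneg hℓ hδ.le)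
    calc δ * N ≤ δ * (ℓ / δ) := mul_le_mul_of_nonneg_left h1 hδ.le
      _ = ℓ := mul_div_cancel₀ ℓ hδ.ne'
  have hNgt : ℓ - δ * N ≤ δ := by
    have h1 : ℓ / δ < N + 1 := Nat.lt_floor_add_one _
    have h2 : ℓ < δ * (N + 1) := by
      calc ℓ = δ * (ℓ / δ) := (mul_div_cancel₀ ℓ hδ.ne').symm
        _ < δ * (N + 1) := mul_lt_mul_of_pos_left h1 hδ
    linarith
  have hM0 : 0 ≤ M := (abs_nonneg _).trans (hM 0 ⟨le_rfl, hℓ⟩)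
  have hN0 : 0 ≤ δ * (N : ℝ) := by positivity
  -- full cells: the lemma with `i₀ = 1`
  have hk' : IntervalIntegrable k volume 0 (δ * N) := hk.mono_set (by
    rw [uIcc_of_le hℓ, uIcc_of_le hN0]; exact Icc_subset_Icc le_rfl hNle)
  have hF' : IntervalIntegrable F volume 0 (δ * N) := hFi.mono_set (by
    rw [uIcc_of_le hℓ, uIcc_of_le hN0]; exact Icc_subset_Icc le_rfl hNle)
  have e1 : (δ * ((1 : ℕ) : ℝ) - δ : ℝ) = 0 := by push_cast; ring
  have e2 : (δ * ((1 : ℕ) : ℝ) - δ + δ * N : ℝ) = δ * N := by push_cast; ring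
  have hk'' : IntervalIntegrable k volume (δ * ((1 : ℕ) : ℝ) - δ) (δ * ((1 : ℕ) : ℝ) - δ + δ * N) := by
    rw [e2, e1]; exact hk'
  have hF'' : IntervalIntegrable F volume (δ * ((1 : ℕ) : ℝ) - δ) (δ * ((1 : ℕ) : ℝ) - δ + δ * N) := by
    rw [e2, e1]; exact hF'
  have hmod : ∀ s₁ s₂, δ * ((1 : ℕ) : ℝ) - δ ≤ s₁ → s₁ ≤ s₂ → s₂ ≤ δ * ((1 : ℕ) : ℝ) - δ + δ * N →
      |F s₂ - F s₁| ≤ ∫ x in s₁..s₂, k x := by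
    intro s₁ s₂ h1 h2 h3
    rw [e1] at h1
    rw [e2] at h3
    exact hF s₁ s₂ h1 h2 (h3.trans hNle)
  have hcells := abs_sum_sub_integral_le (F := F) (k := k) hδ 1 N hk0 hk'' hF'' hmod
  rw [e2, e1] at hcells
  have e3 : ∑ j ∈ Finset.range N, F (δ * (((1 : ℕ) : ℝ) + j)) = ∑ j ∈ Finset.range N, F (δ * (j + 1)) :=
    Finset.sum_congr rfl fun j _ => by push_cast; ring_nf
  rw [e3] at hcells
  -- the tail
  have htail : -(δ * M) ≤ ∫ x in (δ * N)..ℓ, F x := by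
    have h1 : ‖∫ x in (δ * N)..ℓ, F x‖ ≤ M * |ℓ - δ * N| :=
      intervalIntegral.norm_integral_le_of_norm_le_const fun x hx => by
        rw [uIoc_of_le hNle] at hx
        rw [Real.norm_eq_abs]
        exact hM x ⟨hN0.trans hx.1.le, hx.2⟩
    rw [abs_of_nonneg (by linarith), Real.norm_eq_abs] at h1
    have h2 : M * (ℓ - δ * N) ≤ δ * M := by nlinarith
    have := neg_abs_le (∫ x in (δ * N)..ℓ, F x)
    linarith
  -- assemble
  have hsplit : ∫ x in (0 : ℝ)..ℓ, F x = (∫ x in (0 : ℝ)..(δ * N), F x) + ∫ x in (δ * N)..ℓ, F x :=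
    (intervalIntegral.integral_add_adjacent_intervals hF' (hFi.mono_set (by
      rw [uIcc_of_le hℓ, uIcc_of_le hNle]; exact Icc_subset_Icc hN0 le_rfl))).symm
  have hkmono : ∫ x in (0 : ℝ)..(δ * N), k x ≤ ∫ x in (0 : ℝ)..ℓ, k x :=
    intervalIntegral.integral_mono_interval le_rfl hN0 hNle (ae_of_all _ fun x => hk0 x) hk
  have := abs_le.1 hcells
  nlinarith [this.1, this.2, hkmono, hδ.le, htail, hsplit]

end Riemann

/-! ## Counting grid points in a window -/

/-- **Grid points in a window.** For `0 < δ ≤ S` and `t > S + 2δ`, with `i₀ = ⌈(t-S)/δ⌉` and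
`i₁ = ⌈t/δ⌉`: the grid points `δ i`, `i₀ ≤ i < i₁`, lie in `[t - S, t)`; `i₀ ≤ i₁`; the number
`L = i₁ - i₀` of them satisfies `S - δ ≤ δL ≤ S + δ`; their cells cover `(δ i₀ - δ, δ i₀ - δ + δL]`
with `t - S - δ ≤ δ i₀ - δ` and `δ i₀ - δ + δL < t`; and `1 ≤ i₀`. [folklore] -/
theorem grid_count {δ S t : ℝ} (hδ : 0 < δ) (hδS : δ ≤ S) (ht : S + 2 * δ < t) :
    (∀ i : ℕ, ⌈(t - S) / δ⌉₊ ≤ i → i < ⌈t / δ⌉₊ → t - S ≤ δ * i ∧ δ * i < t) ∧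
    ⌈(t - S) / δ⌉₊ ≤ ⌈t / δ⌉₊ ∧
    S - δ ≤ δ * ((⌈t / δ⌉₊ - ⌈(t - S) / δ⌉₊ : ℕ) : ℝ) ∧ δ * ((⌈t / δ⌉₊ - ⌈(t - S) / δ⌉₊ : ℕ) : ℝ) ≤ S + δ ∧
    t - S - δ ≤ δ * ⌈(t - S) / δ⌉₊ - δ ∧
    δ * ⌈(t - S) / δ⌉₊ - δ + δ * ((⌈t / δ⌉₊ - ⌈(t - S) / δ⌉₊ : ℕ) : ℝ) < t ∧ 1 ≤ ⌈(t - S) / δ⌉₊ := by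
  set i₀ : ℕ := ⌈(t - S) / δ⌉₊ with hi₀
  set i₁ : ℕ := ⌈t / δ⌉₊ with hi₁
  have htS : 0 ≤ (t - S) / δ := div_nonneg (by linarith) hδ.le
  have ht0 : 0 ≤ t / δ := div_nonneg (by linarith) hδ.le
  -- `t - S ≤ δ i₀ < t - S + δ`
  have h0a : t - S ≤ δ * i₀ := by
    have := Nat.le_ceil ((t - S) / δ)
    rw [← hi₀] at this
    calc t - S = δ * ((t - S) / δ) := (mul_div_cancel₀ _ hδ.ne').symm
      _ ≤ δ * i₀ := mul_le_mul_of_nonneg_left this hδ.le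
  have h0b : δ * i₀ < t - S + δ := by
    have := Nat.ceil_lt_add_one htS
    rw [← hi₀] at this
    calc δ * i₀ < δ * ((t - S) / δ + 1) := mul_lt_mul_of_pos_left this hδ
      _ = t - S + δ := by field_simp
  -- `t ≤ δ i₁ < t + δ`
  have h1a : t ≤ δ * i₁ := by
    have := Nat.le_ceil (t / δ)
    rw [← hi₁] at this
    calc t = δ * (t / δ) := (mul_div_cancel₀ _ hδ.ne').symm
      _ ≤ δ * i₁ := mul_le_mul_of_nonneg_left this hδ.le
  have h1b : δ * i₁ < t + δ := by
    have := Nat.ceil_lt_add_one ht0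
    rw [← hi₁] at this
    calc δ * i₁ < δ * (t / δ + 1) := mul_lt_mul_of_pos_left this hδ
      _ = t + δ := by field_simp
  have h01 : i₀ ≤ i₁ := by
    have : (i₀ : ℝ) < i₁ := by
      by_contra hc
      rw [not_lt] at hc
      have := mul_le_mul_of_nonneg_left hc hδ.le
      linarith
    exact_mod_cast this.le
  have hcast : ((i₁ - i₀ : ℕ) : ℝ) = i₁ - i₀ := Nat.cast_sub h01
  refine ⟨fun i hi hi' => ?_, h01, ?_, ?_, by linarith, ?_, ?_⟩
  · have hi1 : (i : ℝ) + 1 ≤ i₁ := by exact_mod_cast hi'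
    have hi0 : (i₀ : ℝ) ≤ i := by exact_mod_cast hi
    constructor
    · calc t - S ≤ δ * i₀ := h0a
        _ ≤ δ * i := mul_le_mul_of_nonneg_left hi0 hδ.le
    · have := mul_le_mul_of_nonneg_left hi1 hδ.le
      linarith
  · rw [hcast]; nlinarith
  · rw [hcast]; nlinarith
  · rw [hcast]; nlinarith
  · have : 0 < i₀ := by
      rw [hi₀]
      exact Nat.ceil_pos.2 (div_pos (by linarith) hδ)
    exact this

/-! ## Finite double sums: diagonal plus twice the upper triangle -/

/-- `∑ᵢ∑ⱼ Gᵢⱼ = ∑ᵢ Gᵢᵢ + 2∑ᵢ∑_{j>i} Gᵢⱼ` over a finite set of naturals, for symmetric `G`. [folklore] -/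
theorem sum_sum_eq_diag_add_two_mul_upper (s : Finset ℕ) (G : ℕ → ℕ → ℝ) (hG : ∀ i j, G i j = G j i) :
    ∑ i ∈ s, ∑ j ∈ s, G i j = ∑ i ∈ s, G i i + 2 * ∑ i ∈ s, ∑ j ∈ s.filter (fun j => i < j), G i j := by
  classical
  -- split the inner sum by trichotomy
  have hsplit : ∀ i ∈ s, ∑ j ∈ s, G i j = (∑ j ∈ s.filter (fun j => j < i), G i j) + G i i +
      ∑ j ∈ s.filter (fun j => i < j), G i j := by
    intro i hi
    rw [Finset.sum_filter, Finset.sum_filter]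
    have e : ∀ j ∈ s, G i j = (if j < i then G i j else 0) + (if j = i then G i j else 0) + (if i < j then G i j else 0) := by
      intro j _
      rcases lt_trichotomy j i with h | h | h
      · simp [h, h.ne, not_lt.2 h.le]
      · subst h; simp
      · simp [h, h.ne', not_lt.2 h.le]
    rw [Finset.sum_congr rfl e, Finset.sum_add_distrib, Finset.sum_add_distrib, Finset.sum_ite_eq' s i, if_pos hi]
  rw [Finset.sum_congr rfl hsplit, Finset.sum_add_distrib, Finset.sum_add_distrib]
  -- the lower triangle equals the upper one
  have hlow : ∑ i ∈ s, ∑ j ∈ s.filter (fun j => j < i), G i j = ∑ i ∈ s, ∑ j ∈ s.filter (fun j => i < j), G i j := by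
    simp_rw [Finset.sum_filter]
    rw [Finset.sum_comm]
    refine Finset.sum_congr rfl fun i _ => Finset.sum_congr rfl fun j _ => ?_
    by_cases h : i < j
    · simp [h, hG j i]
    · simp [h]
  rw [hlow]
  ring

/-- `2∑ᵢ∑_{j>i} aᵢaⱼ ≤ (∑ᵢ aᵢ)²` for `a ≥ 0`. [folklore] -/
theorem two_mul_sum_upper_le_sq_sum (s : Finset ℕ) (a : ℕ → ℝ) (ha : ∀ i, 0 ≤ a i) :
    2 * ∑ i ∈ s, ∑ j ∈ s.filter (fun j => i < j), a i * a j ≤ (∑ i ∈ s, a i) ^ 2 := by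
  have h := sum_sum_eq_diag_add_two_mul_upper s (fun i j => a i * a j) fun i j => mul_comm _ _
  rw [sq, Finset.sum_mul_sum, h]
  have : 0 ≤ ∑ i ∈ s, a i * a i := Finset.sum_nonneg fun i _ => mul_nonneg (ha i) (ha i)
  linarith

/-! ## Completing the square over finitely many releases -/

/-- **Completing the square.** For `θ, Aᵢ ∈ L²` and a finite set of indices,
`δ∑ᵢ∫θAᵢ - δ²∑ᵢ∑_{j>i}∫AᵢAⱼ ≤ ½∫θ² + ½δ²∑ᵢ∫Aᵢ²`
(`Y = δ∑Aᵢ`: `‖Y‖² = δ²∑‖Aᵢ‖² + 2δ²∑_{i<j}(Aᵢ,Aⱼ)` and `(θ,Y) ≤ ½‖θ‖² + ½‖Y‖²`). [folklore] -/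
theorem sum_integral_mul_sub_upper_le {α : Type*} [MeasurableSpace α] {μ : Measure α} (s : Finset ℕ) (δ : ℝ)
    {θ : α → ℝ} {A : ℕ → α → ℝ} (hθ : MemLp θ 2 μ) (hA : ∀ i ∈ s, MemLp (A i) 2 μ) :
    δ * ∑ i ∈ s, ∫ x, θ x * A i x ∂μ - δ ^ 2 * ∑ i ∈ s, ∑ j ∈ s.filter (fun j => i < j), ∫ x, A i x * A j x ∂μ ≤
      (1 / 2) * ∫ x, θ x ^ 2 ∂μ + (1 / 2) * δ ^ 2 * ∑ i ∈ s, ∫ x, A i x ^ 2 ∂μ := by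
  classical
  set Y : α → ℝ := fun x => δ * ∑ i ∈ s, A i x with hY
  have hsumm : MemLp (fun x => ∑ i ∈ s, A i x) 2 μ := memLp_finsetSum s hA
  have hYm : MemLp Y 2 μ := hsumm.const_mul δ
  -- integrability of the products
  have iθA : ∀ i ∈ s, Integrable (fun x => θ x * A i x) μ := fun i hi => hθ.integrable_mul (hA i hi)
  have iAA : ∀ i ∈ s, ∀ j ∈ s, Integrable (fun x => A i x * A j x) μ := fun i hi j hj => (hA i hi).integrable_mul (hA j hj)
  have iθY : Integrable (fun x => θ x * Y x) μ := hθ.integrable_mul hYm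
  have iθ2 : Integrable (fun x => θ x ^ 2) μ := hθ.integrable_sq
  have iY2 : Integrable (fun x => Y x ^ 2) μ := hYm.integrable_sq
  -- `∫ θY = δ ∑ ∫ θAᵢ`
  have e1 : ∫ x, θ x * Y x ∂μ = δ * ∑ i ∈ s, ∫ x, θ x * A i x ∂μ := by
    rw [← integral_finsetSum s iθA, ← integral_const_mul]
    refine integral_congr_ae (Eventually.of_forall fun x => ?_)
    simp only [hY, Finset.mul_sum]
    refine Finset.sum_congr rfl fun i _ => by ring
  -- `∫ Y² = δ² ∑ᵢ∑ⱼ ∫ AᵢAⱼ`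
  have e2 : ∫ x, Y x ^ 2 ∂μ = δ ^ 2 * ∑ i ∈ s, ∑ j ∈ s, ∫ x, A i x * A j x ∂μ := by
    have e3 : ∀ x, Y x ^ 2 = δ ^ 2 * ∑ i ∈ s, ∑ j ∈ s, A i x * A j x := fun x => by
      simp only [hY]; rw [mul_pow, sq (∑ i ∈ s, A i x), Finset.sum_mul_sum]
    simp_rw [e3]
    rw [integral_const_mul, integral_finsetSum s fun i hi => integrable_finsetSum s fun j hj => iAA i hi j hj]
    congr 1
    exact Finset.sum_congr rfl fun i hi => integral_finsetSum s fun j hj => iAA i hi j hj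
  have e4 := sum_sum_eq_diag_add_two_mul_upper s (fun i j => ∫ x, A i x * A j x ∂μ) fun i j =>
    integral_congr_ae (Eventually.of_forall fun x => mul_comm _ _)
  -- `(θ, Y) ≤ ½‖θ‖² + ½‖Y‖²`
  have hcs : ∫ x, θ x * Y x ∂μ ≤ (1 / 2) * ∫ x, θ x ^ 2 ∂μ + (1 / 2) * ∫ x, Y x ^ 2 ∂μ := by
    rw [← integral_const_mul, ← integral_const_mul, ← integral_add (iθ2.const_mul _) (iY2.const_mul _)]
    refine integral_mono iθY ((iθ2.const_mul _).add (iY2.const_mul _)) fun x => ?_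
    dsimp only
    nlinarith [sq_nonneg (θ x - Y x)]
  have hdiag : ∑ i ∈ s, (fun i j => ∫ x, A i x * A j x ∂μ) i i = ∑ i ∈ s, ∫ x, A i x ^ 2 ∂μ :=
    Finset.sum_congr rfl fun i _ => integral_congr_ae (Eventually.of_forall fun x => by dsimp only; ring)
  rw [e2, e4, hdiag] at hcs
  rw [← e1]
  nlinarith [hcs, sq_nonneg δ]

/-! ## Piecewise constant functions on the grid -/

section Piecewise

variable {c : ℕ → ℝ} {δ : ℝ}

/-- The grid step function `s ↦ c(⌈s/δ⌉ - 1)` (for `s > 0`) takes the value `c n` on the cell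
`(δn, δ(n+1)]`. [folklore] -/
theorem gridFun_apply (hδ : 0 < δ) {n : ℕ} {s : ℝ} (hs : s ∈ Ioc (δ * n) (δ * (n + 1))) :
    (fun s : ℝ => if 0 < s then c (⌈s / δ⌉₊ - 1) else 0) s = c n := by
  have hs0 : 0 < s := lt_of_le_of_lt (by positivity) hs.1
  simp only [hs0, if_true]
  have hceil : ⌈s / δ⌉₊ = n + 1 := by
    rw [Nat.ceil_eq_iff (Nat.succ_ne_zero n)]
    constructor
    · have e : (n.succ - 1 : ℕ) = n := by simp
      rw [e, lt_div_iff₀ hδ]; linarith [hs.1]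
    · rw [div_le_iff₀ hδ]; push_cast; linarith [hs.2]
  rw [hceil, Nat.add_sub_cancel]

/-- The grid step function is measurable. [folklore] -/
theorem measurable_gridFun (c : ℕ → ℝ) (δ : ℝ) :
    Measurable (fun s : ℝ => if 0 < s then c (⌈s / δ⌉₊ - 1) else 0) := by
  refine Measurable.ite measurableSet_Ioi ?_ measurable_const
  have h1 : Measurable fun s : ℝ => ⌈s / δ⌉₊ := Nat.measurable_ceil.comp (measurable_id.div_const δ)
  exact (measurable_from_top (f := fun n : ℕ => c (n - 1))).comp h1

/-- The grid step function is nonnegative for `c ≥ 0`. [folklore] -/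
theorem gridFun_nonneg (hc : ∀ n, 0 ≤ c n) (s : ℝ) :
    0 ≤ (fun s : ℝ => if 0 < s then c (⌈s / δ⌉₊ - 1) else 0) s := by
  dsimp only; split_ifs <;> simp [hc]

/-- The grid step function is bounded by any bound of `|c|`. [folklore] -/
theorem abs_gridFun_le {C : ℝ} (hC : 0 ≤ C) (hc : ∀ n, |c n| ≤ C) (s : ℝ) :
    |(fun s : ℝ => if 0 < s then c (⌈s / δ⌉₊ - 1) else 0) s| ≤ C := by
  dsimp only; split_ifs <;> simp [hc, hC]

/-- A bounded grid step function is integrable on every bounded interval. [folklore] -/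
theorem intervalIntegrable_gridFun {C : ℝ} (hC : 0 ≤ C) (hc : ∀ n, |c n| ≤ C) (a b : ℝ) :
    IntervalIntegrable (fun s : ℝ => if 0 < s then c (⌈s / δ⌉₊ - 1) else 0) volume a b := by
  refine (intervalIntegrable_const (c := C)).mono_fun' (measurable_gridFun c δ).aestronglyMeasurable ?_
  exact Eventually.of_forall fun s => by dsimp only; rw [Real.norm_eq_abs]; exact abs_gridFun_le hC hc s

/-- **Integral over one cell**: `∫_{δn}^{δ(n+1)} (grid step) = δ c n`. [folklore] -/
theorem integral_gridFun_cell (hδ : 0 < δ) (n : ℕ) :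
    ∫ s in (δ * n)..(δ * (n + 1)), (fun s : ℝ => if 0 < s then c (⌈s / δ⌉₊ - 1) else 0) s = δ * c n := by
  have hle : δ * n ≤ δ * (n + 1) := by nlinarith
  rw [intervalIntegral.integral_of_le hle, setIntegral_congr_fun measurableSet_Ioc
    (fun s hs => gridFun_apply (c := c) hδ hs), setIntegral_const]
  simp only [smul_eq_mul, Real.volume_real_Ioc_of_le hle]
  ring

/-- **Integral over consecutive cells**: `∫_{δi₀-δ}^{δi₀-δ+δL} (grid step) = δ ∑_{j<L} c(i₀ - 1 + j)`
for `i₀ ≥ 1`. [folklore] -/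
theorem integral_gridFun_cells (hδ : 0 < δ) {C : ℝ} (hC : 0 ≤ C) (hc : ∀ n, |c n| ≤ C) {i₀ : ℕ} (hi₀ : 1 ≤ i₀) (L : ℕ) :
    ∫ s in (δ * i₀ - δ)..(δ * i₀ - δ + δ * L), (fun s : ℝ => if 0 < s then c (⌈s / δ⌉₊ - 1) else 0) s =
      δ * ∑ j ∈ Finset.range L, c (i₀ - 1 + j) := by
  set a : ℕ → ℝ := fun j => δ * i₀ - δ + δ * j with ha
  have hcast : ((i₀ - 1 : ℕ) : ℝ) = i₀ - 1 := by rw [Nat.cast_sub hi₀, Nat.cast_one]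
  have hcell : ∀ j, ∫ s in a j..a (j + 1), (fun s : ℝ => if 0 < s then c (⌈s / δ⌉₊ - 1) else 0) s = δ * c (i₀ - 1 + j) := by
    intro j
    have e1 : a j = δ * ((i₀ - 1 + j : ℕ) : ℝ) := by simp only [ha]; push_cast; rw [hcast]; ring
    have e2 : a (j + 1) = δ * (((i₀ - 1 + j : ℕ) : ℝ) + 1) := by simp only [ha]; push_cast; rw [hcast]; ring
    rw [e1, e2]
    exact integral_gridFun_cell hδ _
  have hsum := intervalIntegral.sum_integral_adjacent_intervals (a := a) (n := L)
    (f := fun s : ℝ => if 0 < s then c (⌈s / δ⌉₊ - 1) else 0) (μ := volume) fun j _ =>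
    intervalIntegrable_gridFun (c := c) (δ := δ) hC hc _ _
  have ha0 : a 0 = δ * i₀ - δ := by simp [ha]
  rw [ha0] at hsum
  rw [← hsum, Finset.mul_sum]
  exact Finset.sum_congr rfl fun j _ => hcell j


/-- **Running means of a grid step function versus discrete Cesàro means.** For
`0 ≤ c ≤ C`, the `limsup` of the running time means of the grid step function is at most the
`limsup` of the discrete Cesàro means `N⁻¹∑_{n<N} c n`
(`T⁻¹∫₀ᵀ w ≤ (δN/T) N⁻¹∑_{n<N} c n` with `N = ⌈T/δ⌉`, `δN < T + δ`). [folklore] -/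
theorem longTimeAvgSup_gridFun_le (hδ : 0 < δ) {C : ℝ} (hc0 : ∀ n, 0 ≤ c n) (hcC : ∀ n, c n ≤ C) :
    longTimeAvgSup (fun s : ℝ => if 0 < s then c (⌈s / δ⌉₊ - 1) else 0) ≤
      limsup (fun N : ℕ => (N : ℝ)⁻¹ * ∑ n ∈ Finset.range N, c n) atTop := by
  set w : ℝ → ℝ := fun s => if 0 < s then c (⌈s / δ⌉₊ - 1) else 0 with hw
  set m : ℕ → ℝ := fun N => (N : ℝ)⁻¹ * ∑ n ∈ Finset.range N, c n with hm
  have hC0 : 0 ≤ C := (hc0 0).trans (hcC 0)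
  have hcabs : ∀ n, |c n| ≤ C := fun n => by rw [abs_of_nonneg (hc0 n)]; exact hcC n
  have hw0 : ∀ s, 0 ≤ w s := fun s => gridFun_nonneg hc0 s
  have hm0 : ∀ N, 0 ≤ m N := fun N => mul_nonneg (inv_nonneg.2 (Nat.cast_nonneg N))
    (Finset.sum_nonneg fun n _ => hc0 n)
  have hmC : ∀ N, m N ≤ C := by
    intro N
    rcases Nat.eq_zero_or_pos N with hN | hN
    · simp [hm, hN, hC0]
    · have h1 : ∑ n ∈ Finset.range N, c n ≤ N * C := by
        calc ∑ n ∈ Finset.range N, c n ≤ ∑ _n ∈ Finset.range N, C := Finset.sum_le_sum fun n _ => hcC n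
          _ = N * C := by simp
      have hNpos : (0 : ℝ) < N := by exact_mod_cast hN
      calc m N = (N : ℝ)⁻¹ * ∑ n ∈ Finset.range N, c n := rfl
        _ ≤ (N : ℝ)⁻¹ * (N * C) := mul_le_mul_of_nonneg_left h1 (inv_nonneg.2 hNpos.le)
        _ = C := by field_simp
  have hmb : IsBoundedUnder (· ≤ ·) atTop m := ⟨C, eventually_map.2 (Eventually.of_forall hmC)⟩
  have hmcb : IsCoboundedUnder (· ≤ ·) atTop m := isCoboundedUnder_le_of_le atTop (x := 0) fun N => hm0 N
  -- the key finite-`T` bound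
  have hkey : ∀ T, 0 < T → timeMean w T ≤ m ⌈T / δ⌉₊ + δ * C / T := by
    intro T hT
    set N : ℕ := ⌈T / δ⌉₊ with hN
    have hT0 : 0 ≤ T / δ := div_nonneg hT.le hδ.le
    have hNT : T ≤ δ * N := by
      calc T = δ * (T / δ) := (mul_div_cancel₀ T hδ.ne').symm
        _ ≤ δ * N := mul_le_mul_of_nonneg_left (Nat.le_ceil _) hδ.le
    have hNT' : δ * N < T + δ := by
      calc δ * (N : ℝ) < δ * (T / δ + 1) := mul_lt_mul_of_pos_left (Nat.ceil_lt_add_one hT0) hδ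
        _ = T + δ := by field_simp
    have hNpos : 0 < N := Nat.ceil_pos.2 (div_pos hT hδ)
    have hNr : (0 : ℝ) < N := by exact_mod_cast hNpos
    -- `∫₀ᵀ w ≤ ∫₀^{δN} w = δ N m N`
    have hint : ∫ s in (0 : ℝ)..T, w s ≤ δ * ∑ n ∈ Finset.range N, c n := by
      have h1 : ∫ s in (0 : ℝ)..T, w s ≤ ∫ s in (0 : ℝ)..(δ * N), w s :=
        intervalIntegral.integral_mono_interval le_rfl hT.le hNT (ae_of_all _ fun s => hw0 s)
          (intervalIntegrable_gridFun hC0 hcabs _ _)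
      have h2 := integral_gridFun_cells (c := c) hδ hC0 hcabs (le_refl 1) N
      simp only [Nat.cast_one, mul_one, sub_self, zero_add, Nat.sub_self] at h2
      rw [h2] at h1
      exact h1
    have hsum : δ * ∑ n ∈ Finset.range N, c n = δ * N * m N := by
      simp only [hm]; field_simp
    calc timeMean w T = T⁻¹ * ∫ s in (0 : ℝ)..T, w s := rfl
      _ ≤ T⁻¹ * (δ * N * m N) := by rw [← hsum]; exact mul_le_mul_of_nonneg_left hint (inv_nonneg.2 hT.le)
      _ ≤ T⁻¹ * ((T + δ) * m N) := by gcongr; exact hm0 N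
      _ = m N + δ / T * m N := by field_simp
      _ ≤ m N + δ / T * C := by gcongr; exact hmC N
      _ = m ⌈T / δ⌉₊ + δ * C / T := by rw [hN]; ring
  -- `limsup` comparison
  refine le_of_forall_pos_le_add fun ε hε => ?_
  have hev : ∀ᶠ N in atTop, m N < limsup m atTop + ε / 2 :=
    eventually_lt_of_limsup_lt (by linarith) hmb
  obtain ⟨N₀, hN₀⟩ := eventually_atTop.1 hev
  have hT_ev : ∀ᶠ T in atTop, timeMean w T ≤ limsup m atTop + ε := by
    filter_upwards [eventually_ge_atTop (δ * N₀), eventually_ge_atTop (2 * δ * C / ε + 1), eventually_gt_atTop (0 : ℝ)]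
      with T hT1 hT2 hT0
    have h1 : N₀ ≤ ⌈T / δ⌉₊ := by
      have : (N₀ : ℝ) ≤ T / δ := by rw [le_div_iff₀ hδ]; linarith
      exact Nat.cast_le.1 (this.trans (Nat.le_ceil _))
    have h2 : δ * C / T ≤ ε / 2 := by
      rw [div_le_iff₀ hT0]
      have : 2 * δ * C / ε * ε = 2 * δ * C := by field_simp
      nlinarith [mul_le_mul_of_nonneg_right hT2 hε.le]
    linarith [hkey T hT0, hN₀ _ h1]
  exact Filter.limsup_le_of_le (isCoboundedUnder_le_timeMean_of_nonneg hw0) hT_ev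

/-- The running means of a bounded nonnegative grid step function are eventually bounded. [folklore] -/
theorem isBoundedUnder_timeMean_gridFun {C : ℝ} (hc0 : ∀ n, 0 ≤ c n) (hcC : ∀ n, c n ≤ C) :
    IsBoundedUnder (· ≤ ·) atTop (timeMean fun s : ℝ => if 0 < s then c (⌈s / δ⌉₊ - 1) else 0) := by
  have hC0 : 0 ≤ C := (hc0 0).trans (hcC 0)
  have hcabs : ∀ n, |c n| ≤ C := fun n => by rw [abs_of_nonneg (hc0 n)]; exact hcC n
  refine ⟨C, ?_⟩
  rw [eventually_map]
  filter_upwards [eventually_gt_atTop (0 : ℝ)] with T hT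
  have h1 : ∫ s in (0 : ℝ)..T, (fun s : ℝ => if 0 < s then c (⌈s / δ⌉₊ - 1) else 0) s ≤ ∫ _s in (0 : ℝ)..T, C :=
    intervalIntegral.integral_mono_on hT.le (intervalIntegrable_gridFun hC0 hcabs _ _) intervalIntegrable_const
      fun s _ => (le_abs_self _).trans (abs_gridFun_le hC0 hcabs s)
  rw [intervalIntegral.integral_const, smul_eq_mul, sub_zero] at h1
  calc timeMean (fun s : ℝ => if 0 < s then c (⌈s / δ⌉₊ - 1) else 0) T
      = T⁻¹ * ∫ s in (0 : ℝ)..T, (fun s : ℝ => if 0 < s then c (⌈s / δ⌉₊ - 1) else 0) s := rfl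
    _ ≤ T⁻¹ * (T * C) := mul_le_mul_of_nonneg_left h1 (inv_nonneg.2 hT.le)
    _ = C := by field_simp

end Piecewise

end AgeDecoupling

end Literature.Analysis.FluidPDE
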